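import Summits.HubbardSuperconductivity.HubbardLadder.DWavePairFieldKinematicWitness
import Summits.HubbardSuperconductivity.HubbardLadder.Links
import Literature.MathematicalPhysics.QuantumLattice.PairChirality
import Literature.MathematicalPhysics.QuantumLattice.HubbardSzSectorLadder
import Literature.MathematicalPhysics.QuantumLattice.DopedRVBState
import Summits.HubbardSuperconductivity.HubbardSuperconductivity.Theorems.BalabanIRBirGroundStateAverageLROStubSectorProjCommutePair
import HarnessLib

/-!
# The kinematic `d`-wave ceiling `128/π⁴` is attained in the format of rung 0′: sector pigeonhole

pub-hubbard r3 — part 3 of 3 of the SHARPNESS complement to rung 0′ of the R4 ceiling ladder (R4-MEMO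
§9.13; parts: `DWaveFormFactorSumLower` → `DWavePairFieldKinematicWitness` → this file). HONEST FRAMING:
ladder R1–R4 with certified numbers; no claim on H/H₀. NEW cell-side mathematics (not a published result),
staged by the r3 planner seat for a prover/librarian seat. KINEMATIC CALIBRATION ONLY — not a booked rung,
ladder tallies unchanged, no numerics (imports only landed modules and part 2: `Links`, and the Literature
sector vocabulary `PairChirality` / `HubbardSzSectorLadder` / `DopedRVBState`).

CONTENT. Rung 0′ in the tree (`DWavePairFieldKinematicCeiling`): for EVERY torus Hamiltonian family `H`,
every `N : ℕ → ℕ` and every admissible sequence `ψ` of unit ground states of the sectors `(N L, S^z = 0)`,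
`limsup_k dWaveOrderParamSq ψ k ≤ 128/π⁴`. This file proves that constant OPTIMAL in exactly that format:
* `Δ_d†Δ_d` is block diagonal in the `(N↑, N↓)` sectors (`PairChirality.Shifts`,
  `preservesSectors_conjTranspose_pairField_mul`), so by a finite PIGEONHOLE over the sectors
  (`exists_sectorProj_rayleigh_ge`: some nonzero sector component of any `ψ ≠ 0` has a Rayleigh quotient at
  least that of `ψ`, for any sector-preserving `X`) part 2's Fock-space witness yields
  **`exists_sector_pairFieldDensity_ge_kinematic`**: for every `L ≥ 1` some sector `(N, S^z) = (2n, 0)`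
  contains a UNIT vector with `p_d ≥ 128/π⁴ − 22/L` (`n` uncontrolled; spin balance kills `N↑ ≠ N↓`);
* every nonzero sector vector is a ground state of the ZERO Hamiltonian (`isGroundStateInSector_zero`,
  `minEnergyOn 0 K = 0`), so the zero family with these vectors (`sharpSeq`, `sharpSeqN`; the vacuum on the
  empty torus) is ADMISSIBLE and **`exists_admissible_limsup_ge_kinematic`**:
  `∃ H N ψ, (∀ L, Even L → ‖ψ L‖ = 1 ∧ IsGroundStateInSector (H L) (N L) 0 (ψ L)) ∧ 128/π⁴ ≤ limsup (dWaveOrderParamSq ψ)`;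
  `no_admissible_ceiling_below`: no `c < 128/π⁴` can replace `128/π⁴` in rung 0′. Typed node
  `DWavePairFieldKinematicCeilingSharp` + `_holds` (house style). Consequence: a ceiling certificate is
  informative only with `E < 128/π⁴` (R4-MEMO §9.12) and must then use the Hamiltonian.

HONEST LABEL. KINEMATIC CALIBRATION, not a rung: the attaining admissible family is `H = 0` with pigeonhole
(uncontrolled) particle numbers; NOTHING is said about Hubbard (or any interacting) ground states; the
supremum at a PRESCRIBED filling `δ` is NOT proved (orientation only: `128(1−δ²)/π⁴` from the sign-twisted
Dicke state, `126/π⁴` at `δ = 1/8`). No published theorem is cited as a fact; everything is proved here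
from the tree's definitions. [folklore]
-/

noncomputable section

namespace Summit.HubbardSuperconductivity.HubbardLadder

open Matrix Finset Filter Literature.Probability.LatticeModels Literature.MathematicalPhysics.QuantumLattice
open Summit.HubbardSuperconductivity.TwTipContinuation.IsogapTransport
open scoped ComplexOrder ComplexConjugate

variable {L : ℕ} [NeZero L]

/-! ### §4 Fixed-sector witnesses (pigeonhole over the `(N↑, N↓)` sectors) and sharpness in the
format of `DWavePairFieldKinematicCeiling` -/

/-- The real part of `⟨φ, φ⟩` vanishes only for `φ = 0` (complex vectors). [folklore] -/
theorem eq_zero_of_re_star_dotProduct_self_eq_zero {ι : Type*} [Fintype ι] {φ : ι → ℂ}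
    (h : (star φ ⬝ᵥ φ).re = 0) : φ = 0 := by
  have hnn := dotProduct_star_self_nonneg φ
  obtain ⟨-, him⟩ := Complex.nonneg_iff.mp hnn
  exact dotProduct_star_self_eq_zero.mp (Complex.ext (by simpa using h) (by simpa using him.symm))

section SectorPigeonhole

variable {Λ : Type*} [LinearOrder Λ] [Fintype Λ]

/-- Pairing a sector component against any vector only sees that vector's component in the same sector
(the sector projection is an orthogonal projection). [folklore] -/
theorem star_sectorProj_dotProduct_sectorProj (a b : ℕ) (ψ φ : Fock (Orb Λ)) :
    star (sectorProj a b ψ) ⬝ᵥ φ = star (sectorProj a b ψ) ⬝ᵥ sectorProj a b φ := by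
  unfold dotProduct
  refine Finset.sum_congr rfl fun s _ => ?_
  simp only [Pi.star_apply, sectorProj_apply]
  split_ifs with hs
  · rfl
  · simp

/-- Every Fock vector is the sum of its sector components `(N↑, N↓) = (a, b)`, `a, b ≤ |Λ|`.
[folklore] -/
theorem sum_sectorProj_prod_eq (ψ : Fock (Orb Λ)) :
    ∑ p ∈ range (Fintype.card Λ + 1) ×ˢ range (Fintype.card Λ + 1), sectorProj p.1 p.2 ψ = ψ := by
  funext s
  rw [Finset.sum_apply, Finset.sum_eq_single ((upPart s).card, (downPart s).card)]
  · rw [sectorProj_apply, if_pos ⟨rfl, rfl⟩]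
  · rintro ⟨a, b⟩ _ hne
    rw [sectorProj_apply, if_neg]
    rintro ⟨rfl, rfl⟩
    exact hne rfl
  · intro h
    exfalso
    exact h (Finset.mem_product.2 ⟨mem_range.2 (Nat.lt_succ_of_le (card_le_univ _)),
      mem_range.2 (Nat.lt_succ_of_le (card_le_univ _))⟩)

/-- For a sector-preserving `X`, `⟨ψ, Xψ⟩` is the sum of its sector-diagonal terms. [folklore] -/
theorem star_dotProduct_mulVec_eq_sum_sectorProj_prod {X : Matrix (Finset (Orb Λ)) (Finset (Orb Λ)) ℂ}
    (hX : PreservesSectors X) (ψ : Fock (Orb Λ)) :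
    star ψ ⬝ᵥ (X *ᵥ ψ) = ∑ p ∈ range (Fintype.card Λ + 1) ×ˢ range (Fintype.card Λ + 1),
      star (sectorProj p.1 p.2 ψ) ⬝ᵥ (X *ᵥ sectorProj p.1 p.2 ψ) := by
  conv_lhs => rw [show star ψ = star (∑ p ∈ range (Fintype.card Λ + 1) ×ˢ range (Fintype.card Λ + 1),
      sectorProj p.1 p.2 ψ) by rw [sum_sectorProj_prod_eq]]
  rw [star_sum, sum_dotProduct]
  refine Finset.sum_congr rfl fun p _ => ?_
  rw [star_sectorProj_dotProduct_sectorProj, ← hX.mulVec_sectorProj]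

/-- `‖ψ‖²` is the sum of the squared norms of the sector components. [folklore] -/
theorem star_dotProduct_self_eq_sum_sectorProj_prod (ψ : Fock (Orb Λ)) :
    star ψ ⬝ᵥ ψ = ∑ p ∈ range (Fintype.card Λ + 1) ×ˢ range (Fintype.card Λ + 1),
      star (sectorProj p.1 p.2 ψ) ⬝ᵥ sectorProj p.1 p.2 ψ := by
  conv_lhs => rw [show star ψ = star (∑ p ∈ range (Fintype.card Λ + 1) ×ˢ range (Fintype.card Λ + 1),
      sectorProj p.1 p.2 ψ) by rw [sum_sectorProj_prod_eq]]
  rw [star_sum, sum_dotProduct]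
  refine Finset.sum_congr rfl fun p _ => ?_
  rw [star_sectorProj_dotProduct_sectorProj]

/-- Finite pigeonhole for weighted averages: if `Σ w > 0`, `w ≥ 0` and `e` vanishes where `w` does, some
index with `wᵢ > 0` has `eᵢ / wᵢ ≥ (Σ e)/(Σ w)` (cross-multiplied). [folklore] -/
theorem exists_sum_mul_le_mul_sum {ι : Type*} (S : Finset ι) (w e : ι → ℝ) (hw : ∀ i ∈ S, 0 ≤ w i)
    (hwe : ∀ i ∈ S, w i = 0 → e i = 0) (hpos : 0 < ∑ i ∈ S, w i) :
    ∃ i ∈ S, 0 < w i ∧ (∑ j ∈ S, e j) * w i ≤ e i * ∑ j ∈ S, w j := by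
  by_contra hcon
  have hcon' : ∀ i ∈ S, 0 < w i → e i * ∑ j ∈ S, w j < (∑ j ∈ S, e j) * w i := by
    intro i hi h0
    by_contra hge
    exact hcon ⟨i, hi, h0, not_lt.mp hge⟩
  have hex : ∃ i ∈ S, 0 < w i := by
    by_contra hall
    have hall' : ∀ i ∈ S, w i ≤ 0 := fun i hi => not_lt.mp fun h0 => hall ⟨i, hi, h0⟩
    exact absurd (Finset.sum_nonpos hall') (not_le.mpr hpos)
  have hlt : ∑ i ∈ S, e i * ∑ j ∈ S, w j < ∑ i ∈ S, (∑ j ∈ S, e j) * w i := by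
    apply Finset.sum_lt_sum
    · intro i hi
      rcases (hw i hi).eq_or_lt with h0 | h0
      · rw [← h0, hwe i hi h0.symm, zero_mul, mul_zero]
      · exact (hcon' i hi h0).le
    · obtain ⟨i, hi, h0⟩ := hex
      exact ⟨i, hi, hcon' i hi h0⟩
  rw [← Finset.sum_mul, ← Finset.mul_sum] at hlt
  exact lt_irrefl _ hlt

/-- **Sector pigeonhole.** For a sector-preserving `X` and `ψ ≠ 0`, some nonzero sector component
`φ = P_{ab} ψ` has a Rayleigh quotient at least that of `ψ`:
`Re⟨ψ, Xψ⟩ · ‖φ‖² ≤ Re⟨φ, Xφ⟩ · ‖ψ‖²`. [folklore] -/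
theorem exists_sectorProj_rayleigh_ge {X : Matrix (Finset (Orb Λ)) (Finset (Orb Λ)) ℂ}
    (hX : PreservesSectors X) {ψ : Fock (Orb Λ)} (hψ : ψ ≠ 0) :
    ∃ a b : ℕ, sectorProj a b ψ ≠ 0 ∧
      (star ψ ⬝ᵥ (X *ᵥ ψ)).re * (star (sectorProj a b ψ) ⬝ᵥ sectorProj a b ψ).re ≤
        (star (sectorProj a b ψ) ⬝ᵥ (X *ᵥ sectorProj a b ψ)).re * (star ψ ⬝ᵥ ψ).re := by
  classical
  set S := range (Fintype.card Λ + 1) ×ˢ range (Fintype.card Λ + 1) with hS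
  have hW : (star ψ ⬝ᵥ ψ).re =
      ∑ p ∈ S, (star (sectorProj p.1 p.2 ψ) ⬝ᵥ sectorProj p.1 p.2 ψ).re := by
    rw [star_dotProduct_self_eq_sum_sectorProj_prod ψ, Complex.re_sum]
  have hE : (star ψ ⬝ᵥ (X *ᵥ ψ)).re =
      ∑ p ∈ S, (star (sectorProj p.1 p.2 ψ) ⬝ᵥ (X *ᵥ sectorProj p.1 p.2 ψ)).re := by
    rw [star_dotProduct_mulVec_eq_sum_sectorProj_prod hX ψ, Complex.re_sum]
  have hw0 : ∀ p ∈ S, 0 ≤ (star (sectorProj p.1 p.2 ψ) ⬝ᵥ sectorProj p.1 p.2 ψ).re :=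
    fun p _ => (Complex.nonneg_iff.mp (dotProduct_star_self_nonneg _)).1
  have hwe : ∀ p ∈ S, (star (sectorProj p.1 p.2 ψ) ⬝ᵥ sectorProj p.1 p.2 ψ).re = 0 →
      (star (sectorProj p.1 p.2 ψ) ⬝ᵥ (X *ᵥ sectorProj p.1 p.2 ψ)).re = 0 := by
    intro p _ hp
    rw [eq_zero_of_re_star_dotProduct_self_eq_zero hp]
    simp
  have hpos : 0 < ∑ p ∈ S, (star (sectorProj p.1 p.2 ψ) ⬝ᵥ sectorProj p.1 p.2 ψ).re := by
    rw [← hW]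
    rcases (Complex.nonneg_iff.mp (dotProduct_star_self_nonneg ψ)).1.eq_or_lt with h | h
    · exact absurd (eq_zero_of_re_star_dotProduct_self_eq_zero h.symm) hψ
    · exact h
  obtain ⟨p, -, hwp, hle⟩ := exists_sum_mul_le_mul_sum S
    (fun p => (star (sectorProj p.1 p.2 ψ) ⬝ᵥ sectorProj p.1 p.2 ψ).re)
    (fun p => (star (sectorProj p.1 p.2 ψ) ⬝ᵥ (X *ᵥ sectorProj p.1 p.2 ψ)).re) hw0 hwe hpos
  refine ⟨p.1, p.2, fun h0 => hwp.ne' (by simp [h0]), ?_⟩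
  rw [hE, hW]
  exact hle

end SectorPigeonhole

/-- `Δ_d† Δ_d` conserves `N↑` and `N↓` (`Δ_d` has grade `(−1, −1)`). [folklore]
(Filer edit, lit g14: the identical statement is landed as
`BirGroundStateAverageLRO.Softmin.preservesSectors_pairField_dWave_conjTranspose_mul_self`
(route file `BalabanIRBirGroundStateAverageLROStubSectorProjCommutePair`); reused by `alias` per the
gate's `dedup.landed` rule instead of re-proved.) -/
alias preservesSectors_conjTranspose_pairField_mul :=
  Summit.HubbardSuperconductivity.HubbardSuperconductivity.Theorems.BirGroundStateAverageLRO.Softmin.preservesSectors_pairField_dWave_conjTranspose_mul_self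

/-- A spin-balanced vector has no component in a sector with `N↑ ≠ N↓`. [folklore] -/
theorem sectorProj_eq_zero_of_mem_spinBalanced {Λ : Type*} [LinearOrder Λ] [Fintype Λ]
    {ψ : Fock (Orb Λ)} (hψ : ψ ∈ spinBalanced) {a b : ℕ} (hab : a ≠ b) : sectorProj a b ψ = 0 := by
  funext s
  rw [sectorProj_apply, Pi.zero_apply]
  split_ifs with hs
  · refine (mem_spinBalanced_iff ψ).1 hψ s ?_
    change (upPart s).card ≠ (downPart s).card
    rw [hs.1, hs.2]
    exact hab
  · rfl

/-- **A fixed-sector witness (pigeonhole).** For every `L ≥ 1` some particle-number sector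
`(N, S^z) = (2n, 0)` of the torus `(ℤ/Lℤ)²` contains a UNIT vector with `p_d ≥ 128/π⁴ − 22/L`: the
normalised `(n, n)`-sector component of the iso-gap BCS state selected by `exists_sectorProj_rayleigh_ge`
(`Δ_d†Δ_d` is block diagonal; the state is spin-balanced, so only the sectors `N↑ = N↓` occur). The
particle number `2n` is NOT controlled (no statement at a prescribed filling). [folklore] -/
theorem exists_sector_pairFieldDensity_ge_kinematic (L : ℕ) [NeZero L] :
    ∃ n : ℕ, ∃ ψ : Fock (Orb (FermionTorus 2 L)),
      star ψ ⬝ᵥ ψ = 1 ∧ ψ ∈ szSector (2 * n) 0 ∧ 128 / Real.pi ^ 4 - 22 / L ≤ pairFieldDensity L ψ := by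
  have hΨ1 : star (isoBCSState L) ⬝ᵥ isoBCSState L = 1 := isoBCSState_norm
  have hΨ0 : isoBCSState L ≠ 0 := by
    intro h
    rw [h, star_zero, zero_dotProduct] at hΨ1
    exact zero_ne_one hΨ1
  obtain ⟨a, b, hne, hle⟩ :=
    exists_sectorProj_rayleigh_ge (preservesSectors_conjTranspose_pairField_mul L) hΨ0
  have hab : a = b := by
    by_contra hab
    exact hne (sectorProj_eq_zero_of_mem_spinBalanced isoBCSState_mem_spinBalanced hab)
  subst hab
  set φ := sectorProj a a (isoBCSState L) with hφdef
  set A := (pairField dWaveFormFactor L)ᴴ * pairField dWaveFormFactor L with hAdef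
  set w : ℝ := (star φ ⬝ᵥ φ).re with hwdef
  set e : ℝ := (star φ ⬝ᵥ (A *ᵥ φ)).re with hedef
  rw [hΨ1, Complex.one_re, mul_one] at hle
  have hw0 : 0 ≤ w := (Complex.nonneg_iff.mp (dotProduct_star_self_nonneg φ)).1
  have hwpos : 0 < w := by
    rcases hw0.eq_or_lt with h | h
    · exact absurd (eq_zero_of_re_star_dotProduct_self_eq_zero h.symm) hne
    · exact h
  have hwC : star φ ⬝ᵥ φ = ((w : ℝ) : ℂ) := by
    obtain ⟨-, him⟩ := Complex.nonneg_iff.mp (dotProduct_star_self_nonneg φ)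
    exact Complex.ext (by simp [hwdef]) (by simpa using him.symm)
  -- the pair intensity of `φ`: `e ≥ 2Φ² · w`
  have hE := two_mul_sq_sum_abs_dWaveGap_le_re_expect (L := L)
  have he : 2 * (∑ k : TorusSite 2 L, |dWaveGap k|) ^ 2 * w ≤ e :=
    le_trans (mul_le_mul_of_nonneg_right hE hw0) hle
  -- normalise
  set c : ℝ := (Real.sqrt w)⁻¹ with hcdef
  have hc2 : c * c * w = 1 := by
    rw [hcdef, ← mul_inv, Real.mul_self_sqrt hw0, inv_mul_cancel₀ hwpos.ne']
  have hcpos : 0 < c := by rw [hcdef]; exact inv_pos.2 (Real.sqrt_pos.2 hwpos)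
  refine ⟨a, (c : ℂ) • φ, ?_, ?_, ?_⟩
  · rw [star_smul, smul_dotProduct, dotProduct_smul, smul_eq_mul, smul_eq_mul, Complex.star_def,
      Complex.conj_ofReal, hwC, ← Complex.ofReal_mul, ← Complex.ofReal_mul, ← mul_assoc, hc2,
      Complex.ofReal_one]
  · have hmem : φ ∈ szSector (a + a) (((a : ℝ) - a) / 2) :=
      (mem_szSector_iff_isInSector a a φ).2 (isInSector_sectorProj a a _)
    rw [show (a : ℝ) - a = 0 by ring, zero_div, ← two_mul] at hmem
    exact Submodule.smul_mem _ _ hmem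
  · refine kinematic_sub_le_pairFieldDensity _ ?_
    rw [mulVec_smul, dotProduct_smul, star_smul, smul_dotProduct, smul_eq_mul, smul_eq_mul,
      Complex.star_def, Complex.conj_ofReal, ← mul_assoc, ← Complex.ofReal_mul, Complex.re_ofReal_mul]
    change 2 * (∑ k : TorusSite 2 L, |dWaveGap k|) ^ 2 ≤ c * c * e
    have : c * c * (2 * (∑ k : TorusSite 2 L, |dWaveGap k|) ^ 2 * w) ≤ c * c * e :=
      mul_le_mul_of_nonneg_left he (by positivity)
    calc 2 * (∑ k : TorusSite 2 L, |dWaveGap k|) ^ 2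
        = c * c * w * (2 * (∑ k : TorusSite 2 L, |dWaveGap k|) ^ 2) := by rw [hc2, one_mul]
      _ = c * c * (2 * (∑ k : TorusSite 2 L, |dWaveGap k|) ^ 2 * w) := by ring
      _ ≤ c * c * e := this

/-- For the ZERO Hamiltonian every nonzero vector of a sector is a ground state in that sector
(`minEnergyOn 0 K = 0`). [folklore] -/
theorem isGroundStateInSector_zero {Λ : Type*} [LinearOrder Λ] [Fintype Λ] {N : ℕ} {M : ℝ}
    {ψ : Fock (Orb Λ)} (hmem : ψ ∈ szSector N M) (hne : ψ ≠ 0) :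
    IsGroundStateInSector (0 : Matrix (Finset (Orb Λ)) (Finset (Orb Λ)) ℂ) N M ψ := by
  refine ⟨hmem, hne, ?_⟩
  have h0 : Matrix.minEnergyOn (0 : Matrix (Finset (Orb Λ)) (Finset (Orb Λ)) ℂ) (szSector N M) = 0 := by
    unfold Matrix.minEnergyOn
    have hsub : {E : ℝ | ∃ φ ∈ szSector N M, star φ ⬝ᵥ φ = 1 ∧
        E = (star φ ⬝ᵥ (0 : Matrix (Finset (Orb Λ)) (Finset (Orb Λ)) ℂ) *ᵥ φ).re} ⊆ {0} := by
      rintro E ⟨φ, -, -, rfl⟩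
      simp
    rcases Set.subset_singleton_iff_eq.mp hsub with h | h
    · rw [h, Real.sInf_empty]
    · rw [h, csInf_singleton]
  rw [h0, Matrix.zero_mulVec, Complex.ofReal_zero, zero_smul]

/-- **The witnessing sequence**: the vacuum on the empty torus (side `0`), and on side `L + 1` a unit
fixed-sector vector of `exists_sector_pairFieldDensity_ge_kinematic` (chosen). [folklore] -/
def sharpSeq : ∀ L : ℕ, Fock (Orb (FermionTorus 2 L))
  | 0 => vacuum
  | L + 1 => Classical.choose (Classical.choose_spec (exists_sector_pairFieldDensity_ge_kinematic (L + 1)))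

/-- The particle numbers of `sharpSeq` (even; `0` on the empty torus). [folklore] -/
def sharpSeqN : ℕ → ℕ
  | 0 => 0
  | L + 1 => 2 * Classical.choose (exists_sector_pairFieldDensity_ge_kinematic (L + 1))

/-- The defining properties of `sharpSeq (L + 1)`. [folklore] -/
theorem sharpSeq_spec_succ (L : ℕ) :
    star (sharpSeq (L + 1)) ⬝ᵥ sharpSeq (L + 1) = 1 ∧ sharpSeq (L + 1) ∈ szSector (sharpSeqN (L + 1)) 0 ∧
      128 / Real.pi ^ 4 - 22 / ((L + 1 : ℕ) : ℝ) ≤ pairFieldDensity (L + 1) (sharpSeq (L + 1)) :=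
  Classical.choose_spec (Classical.choose_spec (exists_sector_pairFieldDensity_ge_kinematic (L + 1)))

/-- `sharpSeq` is an admissible ground-state sequence of the ZERO Hamiltonian family. [folklore] -/
theorem sharpSeq_admissible (L : ℕ) :
    star (sharpSeq L) ⬝ᵥ sharpSeq L = 1 ∧
      IsGroundStateInSector (0 : Matrix (Finset (Orb (FermionTorus 2 L))) (Finset (Orb (FermionTorus 2 L))) ℂ)
        (sharpSeqN L) 0 (sharpSeq L) := by
  cases L with
  | zero =>
    have h1 : star (vacuum : Fock (Orb (FermionTorus 2 0))) ⬝ᵥ vacuum = 1 := by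
      simp [vacuum, dotProduct, Pi.single_apply]
    have hmem : (vacuum : Fock (Orb (FermionTorus 2 0))) ∈ szSector 0 0 := by
      simpa using (mem_szSector_iff_isInSector 0 0 (vacuum : Fock (Orb (FermionTorus 2 0)))).2
        IsInSector.vacuum
    have hne : (vacuum : Fock (Orb (FermionTorus 2 0))) ≠ 0 := by
      intro h
      rw [h, star_zero, zero_dotProduct] at h1
      exact zero_ne_one h1
    exact ⟨h1, isGroundStateInSector_zero hmem hne⟩
  | succ L =>
    obtain ⟨h1, h2, -⟩ := sharpSeq_spec_succ L
    have hne : sharpSeq (L + 1) ≠ 0 := by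
      intro h
      rw [h, star_zero, zero_dotProduct] at h1
      exact zero_ne_one h1
    exact ⟨h1, isGroundStateInSector_zero h2 hne⟩

/-- **Sharpness in the format of `DWavePairFieldKinematicCeiling`.** The ZERO Hamiltonian family with the
particle numbers `sharpSeqN` and the unit sector ground states `sharpSeq` is admissible in the sense of
`limsup_dWaveOrderParamSq_le_kinematic`, and its order-parameter sequence has `limsup ≥ 128/π⁴`; so the
constant `128/π⁴` of rung 0′ — uniform in the Hamiltonian family — is optimal. HONEST LABEL: says nothing
about HUBBARD ground states; the attaining family is `H = 0` with uncontrolled (pigeonhole) fillings. [folklore] -/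
theorem exists_admissible_limsup_ge_kinematic :
    ∃ (H : TorusHamiltonianFamily) (N : ℕ → ℕ) (ψ : ∀ L, Fock (Orb (FermionTorus 2 L))),
      (∀ L, Even L → star (ψ L) ⬝ᵥ ψ L = 1 ∧ IsGroundStateInSector (H L) (N L) 0 (ψ L)) ∧
        128 / Real.pi ^ 4 ≤ limsup (dWaveOrderParamSq ψ) atTop := by
  refine ⟨fun _ => 0, sharpSeqN, sharpSeq, fun L _ => sharpSeq_admissible L, ?_⟩
  refine le_of_forall_sub_le fun ε hε => ?_
  refine Filter.le_limsup_of_frequently_le (Filter.Eventually.frequently ?_) ?_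
  · obtain ⟨K, hK⟩ := exists_nat_gt (22 / ε)
    filter_upwards [eventually_ge_atTop (max K 1)] with k hk
    have hk1 : 1 ≤ k := le_of_max_le_right hk
    have hkK : K ≤ k := le_of_max_le_left hk
    rw [dWaveOrderParamSq_eq_pairFieldDensity sharpSeq hk1]
    obtain ⟨m, hm⟩ : ∃ m, 2 * k = m + 1 := ⟨2 * k - 1, by omega⟩
    rw [hm]
    have hspec := (sharpSeq_spec_succ m).2.2
    have hm' : ((m + 1 : ℕ) : ℝ) = 2 * k := by exact_mod_cast hm.symm
    have hKε : 22 < (K : ℝ) * ε := by rwa [div_lt_iff₀ hε] at hK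
    have hkK' : (K : ℝ) ≤ k := by exact_mod_cast hkK
    have ht : 22 / ((m + 1 : ℕ) : ℝ) ≤ ε := by
      rw [hm', div_le_iff₀ (by positivity)]
      nlinarith
    linarith
  · refine Filter.isBoundedUnder_of_eventually_le (a := 128 / Real.pi ^ 4 + 2736) ?_
    filter_upwards [eventually_ge_atTop 1] with k hk
    rw [dWaveOrderParamSq_eq_pairFieldDensity sharpSeq hk]
    obtain ⟨m, hm⟩ : ∃ m, 2 * k = m + 1 := ⟨2 * k - 1, by omega⟩
    rw [hm]
    have h := pairFieldDensity_le_kinematic_tail (sharpSeq (m + 1)) (sharpSeq_spec_succ m).1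
    have ht : (2736 : ℝ) / ((m + 1 : ℕ) : ℝ) ≤ 2736 :=
      div_le_self (by norm_num) (by exact_mod_cast Nat.succ_le_succ (Nat.zero_le m))
    linarith

/-- **No admissible-family ceiling below `128/π⁴`.** No constant `c < 128/π⁴` can replace `128/π⁴` in
`limsup_dWaveOrderParamSq_le_kinematic` / `DWavePairFieldKinematicCeiling` (all Hamiltonian families, all
particle-number maps): any ceiling certificate with `E < 128/π⁴` must use the Hamiltonian. [folklore] -/
theorem no_admissible_ceiling_below {c : ℝ} (hc : c < 128 / Real.pi ^ 4) :
    ¬ ∀ (H : TorusHamiltonianFamily) (N : ℕ → ℕ) (ψ : ∀ L, Fock (Orb (FermionTorus 2 L))),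
      (∀ L, Even L → star (ψ L) ⬝ᵥ ψ L = 1 ∧ IsGroundStateInSector (H L) (N L) 0 (ψ L)) →
        limsup (dWaveOrderParamSq ψ) atTop ≤ c := by
  intro h
  obtain ⟨H, N, ψ, hadm, hge⟩ := exists_admissible_limsup_ge_kinematic
  exact (lt_irrefl _) ((hge.trans (h H N ψ hadm)).trans_lt hc)

/-! ### Typed obligation (the cell's house style: `@[conjecture] def` + `_holds`) -/

/-- **Typed statement (R4-format CALIBRATION, kinematic; NOT a ladder rung) — the kinematic `d`-wave
ceiling `128/π⁴` of rung 0′ is ATTAINED.** Some admissible family (a torus Hamiltonian family `H`, a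
particle-number map `N`, unit ground states `ψ_L` of the sectors `(N L, S^z = 0)` for every even `L`, exactly
the hypotheses of `DWavePairFieldKinematicCeiling`) has `limsup_k dWaveOrderParamSq ψ k ≥ 128/π⁴`. PROVED
(`dWavePairFieldKinematicCeilingSharp_holds`, witness: `H = 0`, `N = sharpSeqN`, `ψ = sharpSeq`). Together
with `DWavePairFieldKinematicCeiling`: `128/π⁴` is the exact value of the best Hamiltonian-uniform ceiling.
HONEST LABEL: no statement about Hubbard ground states, no statement at a prescribed filling. [folklore] -/
@[conjecture] def DWavePairFieldKinematicCeilingSharp : Prop :=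
  ∃ (H : TorusHamiltonianFamily) (N : ℕ → ℕ) (ψ : ∀ L, Fock (Orb (FermionTorus 2 L))),
    (∀ L, Even L → star (ψ L) ⬝ᵥ ψ L = 1 ∧ IsGroundStateInSector (H L) (N L) 0 (ψ L)) ∧
      128 / Real.pi ^ 4 ≤ limsup (dWaveOrderParamSq ψ) atTop

/-- **Proof of `DWavePairFieldKinematicCeilingSharp`.** -/
theorem dWavePairFieldKinematicCeilingSharp_holds : DWavePairFieldKinematicCeilingSharp :=
  exists_admissible_limsup_ge_kinematic

end Summit.HubbardSuperconductivity.HubbardLadder
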